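import Summits.ResolutionOfSingularities.ResolutionOfSingularities.Theorems.FrobeniusLadderFInjectiveMacaulayficationClauseLocalizes
import Summits.ResolutionOfSingularities.ResolutionOfSingularities.Theorems.FrobeniusLadderFInjectiveMacaulayficationCmfiClOfVertex
import Literature.RingTheory.TightClosure.CMFILocalizes
import HarnessLib

/-!
# Hashimoto 2010 Cor. 4.7 («CMFI localizes») DISCHARGED from the tree, and (A1) modulo Cor. 5.2 alone
# (crux `FInjectiveMacaulayfication` stmt-ResolutionOfSingularities-15315, chain w45a, THEOREM-D programme (A1); seat res-L1-w45a-stub-2)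

[OURS · L1 W4.5a] Support file (`--supports stmt-ResolutionOfSingularities-15315 --as helper`); NOT a statement of any manuscript; def-free; AI-written
(AI review is weaker than expert review).

* `hashimoto2010_cmfiLocalizes_holds : Hashimoto2010_cmfiLocalizes.{0}` — the named fact `Literature.RingTheory.TightClosure.Hashimoto2010_cmfiLocalizes`
  (Hashimoto 2010 Cor. 4.7 in clause form) IS a tree theorem at universe `0`: it is `ClauseLocalizes.clause_localization` (ideal-theoretic proof
  in the tree: a system of parameters through `P`, CM localizes, one Frobenius-closed parameter ideal suffices) with the clause pair split.
  Debt −1 for the (A1) files `GradedVertexCMFI` / `AssocGradedVertex` / `CmfiClOfVertex`.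
* `cmfiCl_of_vertex` — ThmDSig §3d «vertex ⇒ every prime of `G(F)`» modulo Hashimoto 2010 **Cor. 5.2 ALONE** (hypothesis `hH` = token text of
  the queued named fact `Hashimoto2010_cmfi_of_homogeneousCore` at universe `0`).
[cite: Hashimoto2010, Cor. 4.7; Cor. 5.2] [cite: Matsumura1987, Thm. 17.3 (iii)]
-/

-- single-problem summit: the doubled namespace component is forced
set_option linter.dupNamespace false

noncomputable section

namespace Summit.ResolutionOfSingularities.ResolutionOfSingularities.Theorems.FInjectiveMacaulayfication.CMFILocalizesHolds

open IsLocalRing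
open Summit.ResolutionOfSingularities.ResolutionOfSingularities.Theorems.FInjectiveMacaulayfication
open GDD

/-- **Hashimoto 2010 Cor. 4.7 holds (universe 0)**: CMFI — CM clause ∧ F-clause — passes from a Noetherian local ring of characteristic `p` to
its localizations at primes; by the tree theorem `ClauseLocalizes.clause_localization`. [cite: Hashimoto2010, Cor. 4.7] -/
theorem hashimoto2010_cmfiLocalizes_holds : Literature.RingTheory.TightClosure.Hashimoto2010_cmfiLocalizes.{0} := by
  intro p _ R _ _ _ _ hR P _
  have hmerged : ∀ d : ℕ, ringKrullDim R = d → ∀ s : Fin d → R, (Ideal.span (Set.range s)).radical.IsMaximal →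
      RingTheory.Sequence.IsWeaklyRegular R (List.ofFn s) ∧
      ∀ y : R, (∃ e : ℕ, y ^ p ^ e ∈ Ideal.span ((fun z : R => z ^ p ^ e) '' (Ideal.span (Set.range s) : Set R))) →
        y ∈ Ideal.span (Set.range s) :=
    fun d hd s hs => ⟨hR.1 d hd s hs, hR.2 d hd s hs⟩
  have h := ClauseLocalizes.clause_localization p hmerged P
  exact ⟨fun d hd s hs => (h d hd s hs).1, fun d hd s hs => (h d hd s hs).2⟩

/-- **§3d `cmfiCl_of_vertex` modulo Hashimoto 2010 Cor. 5.2 ALONE** (Cor. 4.7 discharged): if `F` has a Veronese exponent and the CM clause and the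
F-clause hold at the vertex of `G(F)`, they hold at every prime of `G(F)[1/1̄·T⁰]`. [OURS · conditional-result] [cite: Hashimoto2010, Cor. 5.2] -/
theorem cmfiCl_of_vertex
    (hH : ∀ (p : ℕ) [Fact p.Prime] (A : Type) [CommRing A] [IsNoetherianRing A] [CharP A p]
      (𝒜 : ℕ → AddSubgroup A) [GradedRing 𝒜] (P : Ideal A) [P.IsPrime] [(P.homogeneousCore 𝒜).toIdeal.IsPrime],
      ((∀ d : ℕ, ringKrullDim (Localization.AtPrime (P.homogeneousCore 𝒜).toIdeal) = d →
          ∀ s : Fin d → Localization.AtPrime (P.homogeneousCore 𝒜).toIdeal, (Ideal.span (Set.range s)).radical.IsMaximal →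
            RingTheory.Sequence.IsWeaklyRegular (Localization.AtPrime (P.homogeneousCore 𝒜).toIdeal) (List.ofFn s)) ∧
        (∀ d : ℕ, ringKrullDim (Localization.AtPrime (P.homogeneousCore 𝒜).toIdeal) = d →
          ∀ s : Fin d → Localization.AtPrime (P.homogeneousCore 𝒜).toIdeal, (Ideal.span (Set.range s)).radical.IsMaximal →
            ∀ y : Localization.AtPrime (P.homogeneousCore 𝒜).toIdeal,
              (∃ e : ℕ, y ^ p ^ e ∈ Ideal.span ((fun z : Localization.AtPrime (P.homogeneousCore 𝒜).toIdeal => z ^ p ^ e) ''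
                (Ideal.span (Set.range s) : Set (Localization.AtPrime (P.homogeneousCore 𝒜).toIdeal)))) →
              y ∈ Ideal.span (Set.range s))) →
      ((∀ d : ℕ, ringKrullDim (Localization.AtPrime P) = d →
          ∀ s : Fin d → Localization.AtPrime P, (Ideal.span (Set.range s)).radical.IsMaximal →
            RingTheory.Sequence.IsWeaklyRegular (Localization.AtPrime P) (List.ofFn s)) ∧
        (∀ d : ℕ, ringKrullDim (Localization.AtPrime P) = d →
          ∀ s : Fin d → Localization.AtPrime P, (Ideal.span (Set.range s)).radical.IsMaximal →
            ∀ y : Localization.AtPrime P,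
              (∃ e : ℕ, y ^ p ^ e ∈ Ideal.span ((fun z : Localization.AtPrime P => z ^ p ^ e) ''
                (Ideal.span (Set.range s) : Set (Localization.AtPrime P)))) →
              y ∈ Ideal.span (Set.range s))))
    (p : ℕ) [Fact p.Prime] (𝒪 : Type) [CommRing 𝒪] [IsNoetherianRing 𝒪] [IsLocalRing 𝒪] [CharP 𝒪 p]
    (F : MultFiltration 𝒪) (hV : ∃ N, 0 < N ∧ IsVeronese F N)
    (h𝔑 : ∀ (𝔑 : Ideal (Localization.Away (homogBar F 0 1 (one_mem_I_zero 𝒪 F)))) [𝔑.IsMaximal],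
      ((∀ x ∈ maximalIdeal 𝒪, algebraMap 𝒪 (Localization.Away (homogBar F 0 1 (one_mem_I_zero 𝒪 F))) x ∈ 𝔑) ∧
        ∀ (n : ℕ), 0 < n → ∀ (a : 𝒪) (ha : a ∈ F.I n),
          (OreLocalization.numeratorRingHom (homogBar F n a ha) : Localization.Away (homogBar F 0 1 (one_mem_I_zero 𝒪 F))) ∈ 𝔑) →
      SliceableCentre.CMCl (Localization.AtPrime 𝔑) ∧ SliceableCentre.FCl p (Localization.AtPrime 𝔑)) :
    ∀ (𝔓 : Ideal (Localization.Away (homogBar F 0 1 (one_mem_I_zero 𝒪 F)))) [𝔓.IsPrime],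
      SliceableCentre.CMCl (Localization.AtPrime 𝔓) ∧ SliceableCentre.FCl p (Localization.AtPrime 𝔓) :=
  CmfiClOfVertex.cmfiCl_of_vertex hH hashimoto2010_cmfiLocalizes_holds p 𝒪 F hV h𝔑

end Summit.ResolutionOfSingularities.ResolutionOfSingularities.Theorems.FInjectiveMacaulayfication.CMFILocalizesHolds

end
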